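import Mathlib
import HarnessLib
import Summits.ValiantsHypothesis.ValiantsHypothesis.Theorems.MonotoneRestorationOrbitCompressionQPReynoldsDescentFalse
import Summits.ValiantsHypothesis.ValiantsHypothesis.Theorems.MonotoneRestorationOrbitRestorationQPColumnVandermondesNarrowSpan
import Summits.ValiantsHypothesis.ValiantsHypothesis.Theorems.MonotoneRestorationOrbitRestorationQPNarrowSpanAlgebra

/-!
# Newton in SPAN currency: products (and elementary symmetric functions) of a family whose power sums are narrow

Route MonotoneRestoration, crux `OrbitRestorationQP` (stmt-ValiantsHypothesis-18293), SPAN-currency lane of the open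
sub-rung A_∞ (`stub_sigmaPiSigmaValue`); evidence note `SPAN-CURRENCY-A1-g7g4.md` §2 Steps 3, 6, 7 (the Newton glue of
the `ΠΣ` case: an orbit product `Π_{L ∈ O} φ_L` is the top elementary symmetric function of the family `(φ_L)`, hence a
`ℚ`-polynomial in its power sums `Σ_L φ_L^m`).  Helper (`--supports`), def-free.

* `prod_mem_of_psum_mem`, `esymm_mem_of_psum_mem` — in ANY subalgebra: if all power sums `Σ_i φ_i^m` of a finite
  family lie in `A`, so do `Π_i φ_i` and every `e_j(φ)` (Newton's identities, `ReynoldsDescentFalse.esymm_mem_adjoin_psum`,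
  pushed along `aeval φ`);
* **`prod_mem_narrowSpan_of_psum_mem`**, `esymm_mem_narrowSpan_of_psum_mem` — the same for the narrow SPAN
  `span_ℂ {hom_{F,n} : tw F ≤ w}`, which is a subalgebra by `NarrowSpanAlgebra.narrowSpan_mul_mem`.

With `CorePatterns(Affine).sum_placements_pow_(affine)localForm_mem_narrowSpan` (all-placements power sums) this
leaves exactly ONE step for the untwisted `ΠΣ` theorem in span currency: all placements → injective placements
(kernel quotients of the core).  Honest label: infrastructure; no stub closed; VP ≠ VNP untouched.
-/

noncomputable section

-- `Summit.ValiantsHypothesis.ValiantsHypothesis.…` is the tree's single-conjunct layout (Sub = Summit).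
set_option linter.dupNamespace false

namespace Summit.ValiantsHypothesis.ValiantsHypothesis.Theorems

namespace NarrowSpanNewton

open MvPolynomial Finset
open Literature.Computability.AlgebraicComplexity (homPoly)
open Literature.Combinatorics.SimpleGraph (treewidth)

/-! ### In any subalgebra -/

/-- **Power sums in `A` ⇒ elementary symmetric functions in `A`** (Newton, characteristic `0`). [cite: Macdonald1995, I (2.11′)] -/
theorem esymm_mem_of_psum_mem {R : Type*} [CommRing R] [Algebra ℂ R] {ι : Type} [Fintype ι]
    (A : Subalgebra ℂ R) (φ : ι → R) (h : ∀ m : ℕ, (∑ i, φ i ^ m) ∈ A) (j : ℕ) :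
    (∑ t ∈ (univ : Finset ι).powersetCard j, ∏ i ∈ t, φ i) ∈ A := by
  classical
  have key := ReynoldsDescentFalse.esymm_mem_adjoin_psum ι j
  have hmap : aeval φ (MvPolynomial.esymm ι ℂ j) ∈
      Algebra.adjoin ℂ (aeval φ '' Set.range (MvPolynomial.psum ι ℂ)) := by
    rw [Algebra.adjoin_image]
    exact Subalgebra.mem_map.2 ⟨_, key, rfl⟩
  have heval : aeval φ (MvPolynomial.esymm ι ℂ j) = ∑ t ∈ (univ : Finset ι).powersetCard j, ∏ i ∈ t, φ i := by
    simp only [MvPolynomial.esymm, map_sum, map_prod, aeval_X]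
  rw [← heval]
  refine Algebra.adjoin_le ?_ hmap
  rintro _ ⟨_, ⟨m, rfl⟩, rfl⟩
  have : aeval φ (MvPolynomial.psum ι ℂ m) = ∑ i, φ i ^ m := by
    simp only [MvPolynomial.psum, map_sum, map_pow, aeval_X]
  rw [SetLike.mem_coe, this]
  exact h m

/-- **Power sums in `A` ⇒ the product in `A`.** [cite: Macdonald1995, I (2.11′)] -/
theorem prod_mem_of_psum_mem {R : Type*} [CommRing R] [Algebra ℂ R] {ι : Type} [Fintype ι]
    (A : Subalgebra ℂ R) (φ : ι → R) (h : ∀ m : ℕ, (∑ i, φ i ^ m) ∈ A) : (∏ i, φ i) ∈ A := by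
  classical
  have := esymm_mem_of_psum_mem A φ h (Fintype.card ι)
  rwa [← Finset.card_univ, Finset.powersetCard_self, Finset.sum_singleton] at this

/-! ### In the narrow span -/

/-- **Power sums narrow ⇒ elementary symmetric functions narrow** (the narrow span is a subalgebra).
[folklore] -/
theorem esymm_mem_narrowSpan_of_psum_mem (n w : ℕ) {ι : Type} [Fintype ι]
    (φ : ι → MvPolynomial (Fin n × Fin n) ℂ)
    (h : ∀ m : ℕ, (∑ i, φ i ^ m) ∈ Submodule.span ℂ {p : MvPolynomial (Fin n × Fin n) ℂ |
        ∃ (a b : ℕ) (E : Multiset (Fin a × Fin b)),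
          treewidth (SimpleGraph.fromRel fun u v : Fin a ⊕ Fin b =>
            ∃ e ∈ E, u = Sum.inl e.1 ∧ v = Sum.inr e.2) ≤ w ∧ p = homPoly E n ℂ}) (j : ℕ) :
    (∑ t ∈ (univ : Finset ι).powersetCard j, ∏ i ∈ t, φ i) ∈
      Submodule.span ℂ {p : MvPolynomial (Fin n × Fin n) ℂ |
        ∃ (a b : ℕ) (E : Multiset (Fin a × Fin b)),
          treewidth (SimpleGraph.fromRel fun u v : Fin a ⊕ Fin b =>
            ∃ e ∈ E, u = Sum.inl e.1 ∧ v = Sum.inr e.2) ≤ w ∧ p = homPoly E n ℂ} := by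
  have h1 : (1 : MvPolynomial (Fin n × Fin n) ℂ) ∈ Submodule.span ℂ {p : MvPolynomial (Fin n × Fin n) ℂ |
        ∃ (a b : ℕ) (E : Multiset (Fin a × Fin b)),
          treewidth (SimpleGraph.fromRel fun u v : Fin a ⊕ Fin b =>
            ∃ e ∈ E, u = Sum.inl e.1 ∧ v = Sum.inr e.2) ≤ w ∧ p = homPoly E n ℂ} :=
    Submodule.subset_span ⟨0, 0, 0, by rw [NarrowSpanAlgebra.treewidth_patternGraph_empty]; exact Nat.zero_le _,
      (NarrowSpanAlgebra.homPoly_empty_eq_one n).symm⟩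
  exact Submodule.mem_toSubalgebra.1 (esymm_mem_of_psum_mem
    (Submodule.toSubalgebra _ h1 (fun x y hx hy => NarrowSpanAlgebra.narrowSpan_mul_mem n w hx hy)) φ
    (fun m => Submodule.mem_toSubalgebra.2 (h m)) j)

/-- **Power sums narrow ⇒ product narrow**: if all `Σ_i φ_i^m` lie in `span_ℂ {hom_{F,n} : tw F ≤ w}` then so does
`Π_i φ_i`. [folklore] -/
theorem prod_mem_narrowSpan_of_psum_mem (n w : ℕ) {ι : Type} [Fintype ι]
    (φ : ι → MvPolynomial (Fin n × Fin n) ℂ)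
    (h : ∀ m : ℕ, (∑ i, φ i ^ m) ∈ Submodule.span ℂ {p : MvPolynomial (Fin n × Fin n) ℂ |
        ∃ (a b : ℕ) (E : Multiset (Fin a × Fin b)),
          treewidth (SimpleGraph.fromRel fun u v : Fin a ⊕ Fin b =>
            ∃ e ∈ E, u = Sum.inl e.1 ∧ v = Sum.inr e.2) ≤ w ∧ p = homPoly E n ℂ}) :
    (∏ i, φ i) ∈ Submodule.span ℂ {p : MvPolynomial (Fin n × Fin n) ℂ |
        ∃ (a b : ℕ) (E : Multiset (Fin a × Fin b)),
          treewidth (SimpleGraph.fromRel fun u v : Fin a ⊕ Fin b =>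
            ∃ e ∈ E, u = Sum.inl e.1 ∧ v = Sum.inr e.2) ≤ w ∧ p = homPoly E n ℂ} := by
  classical
  have := esymm_mem_narrowSpan_of_psum_mem n w φ h (Fintype.card ι)
  rwa [← Finset.card_univ, Finset.powersetCard_self, Finset.sum_singleton] at this

end NarrowSpanNewton

end Summit.ValiantsHypothesis.ValiantsHypothesis.Theorems

end
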